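import Summits.Ventures.PercRepro.Night2FatZThreeB
import Summits.Ventures.PercRepro.Night2FatDegSingle

/-!
# night-2: the witnesses of the singly degenerate regime at small `N` — side points, free points, unloaded singletons — the case P₂ = {c, c'}, L₀ = ∅

**`exists_small_witnesses_deg`**: for every lossy basis pair of the singly degenerate regime there are sets `U` of side
points, `V` of free points and `E` of points on no non-class basis line (unloaded singletons) of `W ∖ {x}` in one of
four patterns: (α) the line of `M` is not a non-class basis line, `|U| = 2`, `|V| = 1`, `|E| ≥ 2`;
(β) `|U| = 1`, `|V| = 3`, `|E| ≥ 2`; (γ) `|U| = 2`, `|V| = 2`, `|E| ≥ 1`; (δ) `|U| = 1`, `|V| = 2`, `|E| ≥ 3`.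
Each pattern gives the fair share at `N = 6, 7, 8` (`Night2FatDegNumIccA/B`).  The case analysis follows
`exists_side_and_free_deg`: `|P₂| ∈ {0, 1, 2, 3}` basis points of `π₂` off the spine.
Paper `proofs/NIGHT-2-g35.md` §5.
-/

namespace PercRepro.Shadow

open PercRepro.ThmH PercRepro.PerFlat

variable {α : Type*} [DecidableEq α] {M : Matroid α} [M.Finite] {G : Finset α}

/-- The small witnesses when `P₂ = {c, c'}` and `L₀ = ∅` (`|P₃| = 2`): patterns (δ) / (β) according to the class property of `{c, c'}`. -/
theorem deg_wit_case_p2_two_l0_empty {w₀ x : α} {R₁ : Finset α} {c₂ c₃ : α} {B : Finset α} {z : α}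
    (hd : (gr M \ G).card = 2) (hk : kColoops M G = 1) (hfat : (fatClosures M 5 G 2).card ≤ 1) (hR₁2 : rkN M R₁ = 2)
    (hR₁3 : 3 ≤ R₁.card) (hcop : rkN M (insert w₀ (insert x R₁)) ≤ 3)
    (hnd₂ : 3 ≤ rkN M (((G \ coloops M G) \ {w₀, x}).filter (fun e => e ∈ clF M (insert c₂ R₁) ∧ e ∉ clF M R₁)))
    (hdeg₃ : rkN M (((G \ coloops M G) \ {w₀, x}).filter (fun e => e ∈ clF M (insert c₃ R₁) ∧ e ∉ clF M R₁)) ≤ 2)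
    {V P W Mset P₃ M' L₀ P₂ Aset Lset : Finset α} (hV : V = (G \ coloops M G) \ {w₀, x})
    (hP : P = (insert z B \ coloops M G).erase w₀) (hW : W = (G \ insert z B).erase x)
    (hMset : Mset = V.filter (fun e => e ∈ clF M (insert c₃ R₁) ∧ e ∉ clF M R₁))
    (hP₃ : P₃ = P.filter (fun e => e ∈ Mset)) (hM' : M' = W.filter (fun e => e ∈ Mset))
    (hL₀ : L₀ = P.filter (fun e => e ∈ clF M R₁))
    (hP₂ : P₂ = P.filter (fun e => e ∈ clF M (insert c₂ R₁) ∧ e ∉ clF M R₁))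
    (hAset : Aset = V.filter (fun e => e ∈ clF M (insert c₂ R₁) ∧ e ∉ clF M R₁))
    (hLset : Lset = V.filter (fun e => e ∈ clF M R₁)) {y₃ c c' f : α} (hP4 : P.card = 4) (hM3 : 3 ≤ Mset.card)
    (hM2 : 1 < Mset.card) (hP₃2 : P₃.card ≤ 2) (hMsplit : Mset.card = P₃.card + M'.card) (hM'1 : 1 ≤ M'.card)
    (hy₃ : y₃ ∈ W ∧ y₃ ∈ Mset) (hy₃side : y₃ ∈ clF M (insert c₃ R₁) ∧ y₃ ∉ clF M R₁) (hL₀2 : L₀.card ≤ 2)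
    (hπ₂3 : (P.filter (fun e => e ∈ clF M (insert c₂ R₁))).card ≤ 3) (hL₀P₂ : L₀.card + P₂.card ≤ 3)
    (hsplit : L₀.card + P₂.card + P₃.card = 4) (hL3 : 3 ≤ Lset.card) (hLW : ∀ e ∈ Lset, e ∉ L₀ → e ∈ W)
    (hLM : ∀ s ∈ Lset, ∀ s' ∈ Lset, s ≠ s' → s ∈ clF M Mset → s' ∉ clF M Mset) (hA3 : 3 ≤ Aset.card)
    (hL₀1 : L₀.card ≤ 1) (hLWcard : Lset.card ≤ (Lset.filter (fun e => e ∈ W)).card + L₀.card)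
    (hLline : ∀ c ∈ P₂, ∀ c' ∈ P, c ≠ c' → ∀ s ∈ Lset, ∀ s' ∈ Lset, s ≠ s' → s ∈ clF M {c, c'} → s' ∉ clF M {c, c'})
    (hcc' : c ≠ c') (hcmem : c ∈ P₂) (hc'P : c' ∈ P) (hX2 : rkN M ({c, c'} : Finset α) ≤ 2)
    (hspinefree : ∀ s ∈ W, s ∈ clF M R₁ → s ∉ clF M Mset → (s ∈ clF M {c, c'} → rkN M (insert w₀ (insert x {c, c'}))
      ≤ 3 → 4 ≤ rkN M ({c, c'} ∪ Mset)) → s ∉ clF M Mset ∧ ∀ a ∈ P, ∀ b ∈ P, a ≠ b → s ∈ clF M {a, b} → rkN M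
      (insert w₀ (insert x {a, b})) ≤ 3 → 4 ≤ rkN M ({a, b} ∪ Mset))
    (hspinesing : ∀ s ∈ W, s ∈ clF M R₁ → s ∉ clF M Mset → (s ∈ clF M {c, c'} → rkN M (insert w₀ (insert x {c, c'}))
      ≤ 3) → ∀ a ∈ P, ∀ b ∈ P, a ≠ b → s ∈ clF M {a, b} → rkN M (insert w₀ (insert x {a, b})) ≤ 3)
    (hfW : f ∈ W) (hfL : f ∉ clF M R₁)
    (hffree_of : (∀ a ∈ L₀, ∀ d ∈ P₂, a ≠ d → f ∈ clF M {a, d} → rkN M (insert w₀ (insert x {a, d})) ≤ 3 → 4 ≤ rkN M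
      ({a, d} ∪ Mset)) → f ∉ clF M Mset ∧ ∀ a ∈ P, ∀ b ∈ P, a ≠ b → f ∈ clF M {a, b} → rkN M (insert w₀ (insert x
      {a, b})) ≤ 3 → 4 ≤ rkN M ({a, b} ∪ Mset))
    (hfsing_of : (∀ a ∈ L₀, ∀ d ∈ P₂, a ≠ d → f ∈ clF M {a, d} → rkN M (insert w₀ (insert x {a, d})) ≤ 3) → ∀ a ∈ P,
      ∀ b ∈ P, a ≠ b → f ∈ clF M {a, b} → rkN M (insert w₀ (insert x {a, b})) ≤ 3)
    (hP₂2 : 2 ≤ P₂.card) (hP₂2' : P₂.card < 3) (hL₀0 : L₀.card < 1) :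
    ∃ U V E : Finset α, U ⊆ (G \ insert z B).erase x ∧ (∀ y ∈ U, y ∈ clF M (insert c₃ R₁) ∧ y ∉ clF M R₁) ∧ V ⊆ (G
      \ insert z B).erase x ∧ (∀ f ∈ V, f ∉ clF M (((G \ coloops M G) \ {w₀, x}).filter (fun e => e ∈ clF M (insert
      c₃ R₁) ∧ e ∉ clF M R₁)) ∧ ∀ a ∈ (insert z B \ coloops M G).erase w₀, ∀ b ∈ (insert z B \ coloops M G).erase
      w₀, a ≠ b → f ∈ clF M {a, b} → rkN M (insert w₀ (insert x {a, b})) ≤ 3 → 4 ≤ rkN M ({a, b} ∪ (((G \ coloops M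
      G) \ {w₀, x}).filter (fun e => e ∈ clF M (insert c₃ R₁) ∧ e ∉ clF M R₁)))) ∧ E ⊆ (G \ insert z B).erase x ∧ (∀
      y ∈ E, ∀ a ∈ (insert z B \ coloops M G).erase w₀, ∀ b ∈ (insert z B \ coloops M G).erase w₀, a ≠ b → y ∈ clF M
      {a, b} → rkN M (insert w₀ (insert x {a, b})) ≤ 3) ∧ ((¬ (4 ≤ rkN M (insert w₀ (insert x (((G \ coloops M G) \
      {w₀, x}).filter (fun e => e ∈ clF M (insert c₃ R₁) ∧ e ∉ clF M R₁)))) ∧ ∃ a ∈ (insert z B \ coloops M G).erase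
      w₀, ∃ b ∈ (insert z B \ coloops M G).erase w₀, a ≠ b ∧ a ∈ clF M (((G \ coloops M G) \ {w₀, x}).filter (fun e
      => e ∈ clF M (insert c₃ R₁) ∧ e ∉ clF M R₁)) ∧ b ∈ clF M (((G \ coloops M G) \ {w₀, x}).filter (fun e => e ∈
      clF M (insert c₃ R₁) ∧ e ∉ clF M R₁))) ∧ U.card = 2 ∧ V.card = 1 ∧ 2 ≤ E.card) ∨ (U.card = 1 ∧ V.card = 3 ∧ 2
      ≤ E.card) ∨ (U.card = 2 ∧ V.card = 2 ∧ 1 ≤ E.card) ∨ (U.card = 1 ∧ V.card = 2 ∧ 3 ≤ E.card)) := by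
  subst hV hP hW hMset hP₃ hM' hL₀ hP₂ hAset hLset
  set V := (G \ coloops M G) \ {w₀, x} with hV
  set P := (insert z B \ coloops M G).erase w₀ with hP
  set W := (G \ insert z B).erase x with hW
  set Mset := V.filter (fun e => e ∈ clF M (insert c₃ R₁) ∧ e ∉ clF M R₁) with hMset
  set P₃ := P.filter (fun e => e ∈ Mset) with hP₃
  set M' := W.filter (fun e => e ∈ Mset) with hM'
  set L₀ := P.filter (fun e => e ∈ clF M R₁) with hL₀
  set P₂ := P.filter (fun e => e ∈ clF M (insert c₂ R₁) ∧ e ∉ clF M R₁) with hP₂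
  set Aset := V.filter (fun e => e ∈ clF M (insert c₂ R₁) ∧ e ∉ clF M R₁) with hAset
  set Lset := V.filter (fun e => e ∈ clF M R₁) with hLset
  have _u := hd
  have _u := hk
  have _u := hfat
  have _u := hR₁2
  have _u := hR₁3
  have _u := hcop
  have _u := hnd₂
  have _u := hdeg₃
  have _u := hP4
  have _u := hM3
  have _u := hM2
  have _u := hP₃2
  have _u := hMsplit
  have _u := hM'1
  have _u := hL₀2
  have _u := hπ₂3
  have _u := hL₀P₂
  have _u := hsplit
  have _u := hL3
  have _u := hA3
  have _u := hL₀1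
  have _u := hLWcard
  have _u := hX2
  have _u := hP₂2
  have _u := hP₂2'
  have _u := hL₀0
  have hL₀e : L₀ = ∅ := Finset.card_eq_zero.1 (by omega)
  have hnoL₀ : ∀ a, a ∉ L₀ := fun a ha => by rw [hL₀e] at ha; exact Finset.notMem_empty _ ha
  have hLWall : ∀ e ∈ Lset, e ∈ W := fun e he => hLW e he (hnoL₀ e)
  have hffree := hffree_of (fun a ha => absurd ha (hnoL₀ a))
  have hfsing := hfsing_of (fun a ha => absurd ha (hnoL₀ a))
  -- three spine points; at most one in `clF M`, at most one in `clF {c, c'}`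
  obtain ⟨s₁, hs₁, s₂, hs₂, s₃, hs₃, h12, h13, h23⟩ := Finset.two_lt_card.1 (by omega : 2 < Lset.card)
  have hsL : ∀ s ∈ Lset, s ∈ clF M R₁ := fun s hs' => (Finset.mem_filter.1 hs').2
  have hfs : ∀ s ∈ Lset, f ≠ s := by
    intro s hs' h
    subst h
    exact hfL (hsL f hs')
  -- a spine point off `clF M` and off `clF {c, c'}`
  obtain ⟨t, ht, htM, htX⟩ : ∃ t ∈ Lset, t ∉ clF M Mset ∧ t ∉ clF M {c, c'} := by
    by_contra hcon
    push Not at hcon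
    rcases Classical.em (s₁ ∈ clF M Mset) with h1 | h1
    · rcases Classical.em (s₂ ∈ clF M Mset) with h2 | h2
      · exact hLM s₁ hs₁ s₂ hs₂ h12 h1 h2
      · rcases Classical.em (s₃ ∈ clF M Mset) with h3 | h3
        · exact hLM s₁ hs₁ s₃ hs₃ h13 h1 h3
        · exact hLline c hcmem c' hc'P hcc' s₂ hs₂ s₃ hs₃ h23 (hcon s₂ hs₂ h2) (hcon s₃ hs₃ h3)
    · rcases Classical.em (s₂ ∈ clF M Mset) with h2 | h2
      · rcases Classical.em (s₃ ∈ clF M Mset) with h3 | h3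
        · exact hLM s₂ hs₂ s₃ hs₃ h23 h2 h3
        · exact hLline c hcmem c' hc'P hcc' s₁ hs₁ s₃ hs₃ h13 (hcon s₁ hs₁ h1) (hcon s₃ hs₃ h3)
      · exact hLline c hcmem c' hc'P hcc' s₁ hs₁ s₂ hs₂ h12 (hcon s₁ hs₁ h1) (hcon s₂ hs₂ h2)
  have htfree := hspinefree t (hLWall t ht) (hsL t ht) htM (fun h => absurd h htX)
  have htsing := hspinesing t (hLWall t ht) (hsL t ht) htM (fun h => absurd h htX)
  by_cases hcls : rkN M (insert w₀ (insert x {c, c'})) ≤ 3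
  · -- `{c, c'}` a class line: pattern (δ) — `U = {y₃}`, `V = {f, t}`, `E = {f} ∪ (two spine points off clF M)`
    -- every spine point off `clF M` has an unloaded singleton
    have hsingall : ∀ s ∈ Lset, s ∉ clF M Mset →
        ∀ a ∈ P, ∀ b ∈ P, a ≠ b → s ∈ clF M {a, b} → rkN M (insert w₀ (insert x {a, b})) ≤ 3 :=
      fun s hs' hsM => hspinesing s (hLWall s hs') (hsL s hs') hsM (fun _ => hcls)
    -- two spine points off `clF M`
    obtain ⟨u, hu, u', hu', huu', huM, hu'M⟩ : ∃ u ∈ Lset, ∃ u' ∈ Lset, u ≠ u' ∧ u ∉ clF M Mset ∧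
        u' ∉ clF M Mset := by
      rcases Classical.em (s₁ ∈ clF M Mset) with h1 | h1
      · exact ⟨s₂, hs₂, s₃, hs₃, h23, hLM s₁ hs₁ s₂ hs₂ h12 h1, hLM s₁ hs₁ s₃ hs₃ h13 h1⟩
      · rcases Classical.em (s₂ ∈ clF M Mset) with h2 | h2
        · exact ⟨s₁, hs₁, s₃, hs₃, h13, h1, hLM s₂ hs₂ s₃ hs₃ h23 h2⟩
        · exact ⟨s₁, hs₁, s₂, hs₂, h12, h1, h2⟩
    refine ⟨{y₃}, {f, t}, {f, u, u'}, Finset.singleton_subset_iff.2 hy₃.1, ?_, ?_, ?_, ?_, ?_,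
      Or.inr (Or.inr (Or.inr ⟨Finset.card_singleton _, Finset.card_pair (hfs t ht), ?_⟩))⟩
    · intro y hy
      rw [Finset.mem_singleton] at hy
      subst hy
      exact hy₃side
    · intro g hg
      rw [Finset.mem_insert, Finset.mem_singleton] at hg
      rcases hg with rfl | rfl
      · exact hfW
      · exact hLWall g ht
    · intro g hg
      rw [Finset.mem_insert, Finset.mem_singleton] at hg
      rcases hg with rfl | rfl
      · exact hffree
      · exact htfree
    · intro y hy
      simp only [Finset.mem_insert, Finset.mem_singleton] at hy
      rcases hy with rfl | rfl | rfl
      · exact hfW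
      · exact hLWall y hu
      · exact hLWall y hu'
    · intro y hy
      simp only [Finset.mem_insert, Finset.mem_singleton] at hy
      rcases hy with rfl | rfl | rfl
      · exact hfsing
      · exact hsingall y hu huM
      · exact hsingall y hu' hu'M
    · rw [Finset.card_insert_of_notMem, Finset.card_pair huu']
      simp only [Finset.mem_insert, Finset.mem_singleton, not_or]
      exact ⟨hfs u hu, hfs u' hu'⟩
  · -- `{c, c'}` not a class line: pattern (β) — every spine point off `clF M` is free
    have hfreeall : ∀ s ∈ Lset, s ∉ clF M Mset →
        s ∉ clF M Mset ∧ ∀ a ∈ P, ∀ b ∈ P, a ≠ b → s ∈ clF M {a, b} →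
          rkN M (insert w₀ (insert x {a, b})) ≤ 3 → 4 ≤ rkN M ({a, b} ∪ Mset) :=
      fun s hs' hsM => hspinefree s (hLWall s hs') (hsL s hs') hsM (fun _ h => absurd h hcls)
    obtain ⟨u, hu, u', hu', huu', huM, hu'M⟩ : ∃ u ∈ Lset, ∃ u' ∈ Lset, u ≠ u' ∧ u ∉ clF M Mset ∧
        u' ∉ clF M Mset := by
      rcases Classical.em (s₁ ∈ clF M Mset) with h1 | h1
      · exact ⟨s₂, hs₂, s₃, hs₃, h23, hLM s₁ hs₁ s₂ hs₂ h12 h1, hLM s₁ hs₁ s₃ hs₃ h13 h1⟩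
      · rcases Classical.em (s₂ ∈ clF M Mset) with h2 | h2
        · exact ⟨s₁, hs₁, s₃, hs₃, h13, h1, hLM s₂ hs₂ s₃ hs₃ h23 h2⟩
        · exact ⟨s₁, hs₁, s₂, hs₂, h12, h1, h2⟩
    refine ⟨{y₃}, {f, u, u'}, {f, t}, Finset.singleton_subset_iff.2 hy₃.1, ?_, ?_, ?_, ?_, ?_,
      Or.inr (Or.inl ⟨Finset.card_singleton _, ?_, by rw [Finset.card_pair (hfs t ht)]⟩)⟩
    · intro y hy
      rw [Finset.mem_singleton] at hy
      subst hy
      exact hy₃side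
    · intro g hg
      simp only [Finset.mem_insert, Finset.mem_singleton] at hg
      rcases hg with rfl | rfl | rfl
      · exact hfW
      · exact hLWall g hu
      · exact hLWall g hu'
    · intro g hg
      simp only [Finset.mem_insert, Finset.mem_singleton] at hg
      rcases hg with rfl | rfl | rfl
      · exact hffree
      · exact hfreeall g hu huM
      · exact hfreeall g hu' hu'M
    · intro y hy
      rw [Finset.mem_insert, Finset.mem_singleton] at hy
      rcases hy with rfl | rfl
      · exact hfW
      · exact hLWall y ht
    · intro y hy
      rw [Finset.mem_insert, Finset.mem_singleton] at hy
      rcases hy with rfl | rfl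
      · exact hfsing
      · exact htsing
    · rw [Finset.card_insert_of_notMem, Finset.card_pair huu']
      simp only [Finset.mem_insert, Finset.mem_singleton, not_or]
      exact ⟨hfs u hu, hfs u' hu'⟩

end PercRepro.Shadow
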